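import Literature.Computability.QuantumComplexity.OracleCoinLayout
import Literature.Computability.QuantumComplexity.PhaseQueryUniform
import HarnessLib

/-!
# Uniform oracle coin simulation, IV: the coin family is polynomial-time uniform

Fourth file of the `OCoin` discharge of `uniformOracleCoinSimulation` (`CoinFamilyKernel.lean`;
layout and program in `OracleCoinLayout.lean`): **`family_isUniform`**. By
`QCircuitFamily.isUniform_of_descFn_mem_FP` it suffices that the description
`1ⁿ ↦ ⟨bin n, ⟨1^{q(n) + mW n}, encode (circ n)⟩⟩` is in `FP`. The circuit is the Hadamard layer of
`coinFamily` followed by the compilation of `body`, so its encoding is the concatenation of the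
`RtOp.bits` of `hadOps ++ body` (`flatMap_gateEnc_hadamardLayer`,
`RazTalMachine.flatMap_gateEnc_compileList`), printed piecewise as in `PhaseQueryUniform.lean`:

* the Hadamard layer and the output swaps by one-input generator programs (`PhaseQuery.g1F`);
* the clean block by `RevClean.flatMap_opBits_cleanOps_mem_FP` at the data length `DD(u)` and the
  tableau length `nT(u)` written as counter expressions (`DDE`, `nTE`);
* the round-dependent parts of round `t` — the copy of field `t` and the `R + 1` oracle queries
  (their tokens `RazTalMachine.oracleToks` by the generator `orc1G`, as `RazTalMachine.RtGen.oracleG`)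
  — by two-input generators in `u`, `t` (`PhaseQuery.g2F`), assembled with the block description into
  the piece of round `t` and folded over `t < R` (`Brick.foldLoop`).

(Arora–Barak 2009, §6.2 Def. 6.12 and Remark 6.7: descriptions printed with counters;
Bernstein–Vazirani 1997, proof of Thm. 8.3: the dovetailed machine is polynomial time.)

## References

* S. Arora, B. Barak, *Computational Complexity: A Modern Approach*, CUP 2009, §6.2, Remark 6.7,
  Thm. 6.15 (proof), §1.3 [AroraBarak2009].
* E. Bernstein, U. Vazirani, *Quantum complexity theory*, SIAM J. Comput. 26 (1997), Thm. 8.3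
  (proof) and §8.3 [BernsteinVazirani1997SICOMP].
-/

noncomputable section

namespace Literature.Computability.QuantumComplexity

namespace OCoin

open _root_.Computability Polynomial Complexity Complexity.Brick Plumb RevDesc RevSim RevClean Cryptography RazTalMachine
  Turing

variable (P : Params)

/-! ### The layout as counter expressions -/

section Expr

/-- `q(u)`. [folklore] -/
def qnE : GE := CWrap.polyE P.q (.var .uu)
/-- `nx(u) = 2u + 2 + q(u)`. [folklore] -/
def nxE : GE := .add (.add (.mul (.const 2) (.var .uu)) (.const 2)) (qnE P)
/-- `R(u) = r(nx u)`. [folklore] -/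
def RRE : GE := CWrap.polyE P.r (nxE P)
/-- `SS(u) = R (R + 1)`. [folklore] -/
def SSE : GE := .mul (RRE P) (.add (RRE P) (.const 1))
/-- `DD(u)`. [folklore] -/
def DDE : GE := .add (.add (.var .uu) (qnE P)) (SSE P)
/-- `nT(u) = DD(u) + 2u + 2`. [folklore] -/
def nTE : GE := .add (DDE P) (.add (.mul (.const 2) (.var .uu)) (.const 2))
/-- `NN(nT u)`. [folklore] -/
def NNE : GE := CWrap.atE (nTE P) (.add (.var .xn) (ancNE P.Mtm.tm P.e))
/-- `Wblk(u) = width(nT u)`. [folklore] -/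
def WblkE : GE :=
  CWrap.atE (nTE P) (.add (.add (.var .xn) (ancNE P.Mtm.tm P.e)) (.mul (JJE P.e P.Mtm) (.const (A₁ P.Mtm))))
/-- `Tn(nT u)`. [folklore] -/
def TnTE : GE := CWrap.atE (nTE P) (TnE P.e)
/-- The `true`-code result wire of cell `k`. [folklore] -/
def fWE (kE : GE) : GE :=
  .add (NNE P) (.add (.mul kE (.const (A₁ P.Mtm))) (.const ((eA P.Mtm (CWrap.symTrue P.Mtm) : Fin (A₁ P.Mtm)) : ℕ)))
/-- Window wire `i` of round `t`. [folklore] -/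
def winWE (tE iE : GE) : GE := .add (.add (WblkE P) (.mul tE (RRE P))) iE
/-- Slot `(s, ℓ)`. [folklore] -/
def slotWE (sE lE : GE) : GE := .add (.add (.add (.var .uu) (qnE P)) (.mul sE (.add (RRE P) (.const 1)))) lE
/-- `JF(u)` (the closed form of `OracleCoinLayout.JF`). [folklore] -/
def JFE : GE :=
  .add (.add (.add (.add (.add (.var .uu) (qnE P)) (RRE P)) (.add (.mul (.const 2) (.var .uu)) (.const 2)))
    (.mul (.const (dd P.Mtm.tm)) (TnTE P))) (.const (3 * dd P.Mtm.tm))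
/-- `R²`. [folklore] -/
def sqE : GE := .mul (RRE P) (RRE P)

variable {P}
variable (env : GV → ℕ)

/-- Value of `qnE`. [folklore] -/
@[simp] theorem eval_qnE : (qnE P).eval env = qn P (env .uu) := by simp [qnE, GExpr.eval]
/-- Value of `nxE`. [folklore] -/
@[simp] theorem eval_nxE : (nxE P).eval env = nx P (env .uu) := by simp [nxE, nx, GExpr.eval]
/-- Value of `RRE`. [folklore] -/
@[simp] theorem eval_RRE : (RRE P).eval env = RR P (env .uu) := by simp [RRE, RR]
/-- Value of `SSE`. [folklore] -/
@[simp] theorem eval_SSE : (SSE P).eval env = SS P (env .uu) := by simp [SSE, SS, GExpr.eval]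
/-- Value of `DDE`. [folklore] -/
@[simp] theorem eval_DDE : (DDE P).eval env = DD P (env .uu) := by simp [DDE, DD, GExpr.eval]
/-- Value of `nTE`. [folklore] -/
@[simp] theorem eval_nTE : (nTE P).eval env = nT P (env .uu) := by simp [nTE, nT, GExpr.eval]
/-- Value of `NNE`. [folklore] -/
@[simp] theorem eval_NNE : (NNE P).eval env = NN P.e P.Mtm (nT P (env .uu)) := by
  simp only [NNE, CWrap.eval_atE, GExpr.eval, eval_ancNE, Function.update_self, eval_nTE]
/-- Value of `WblkE`. [folklore] -/
@[simp] theorem eval_WblkE : (WblkE P).eval env = Wblk P (env .uu) := by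
  simp only [WblkE, CWrap.eval_atE, GExpr.eval, eval_ancNE, eval_JJE, Function.update_self, eval_nTE]
  rfl
/-- Value of `TnTE`. [folklore] -/
@[simp] theorem eval_TnTE : (TnTE P).eval env = Tn P.e (nT P (env .uu)) := by
  simp only [TnTE, CWrap.eval_atE, eval_TnE, Function.update_self, eval_nTE]
/-- Value of `fWE`. [folklore] -/
@[simp] theorem eval_fWE (kE : GE) : (fWE P kE).eval env = fW P (env .uu) (kE.eval env) := by
  simp only [fWE, GExpr.eval, eval_NNE]; rfl
/-- Value of `winWE`. [folklore] -/
@[simp] theorem eval_winWE (tE iE : GE) : (winWE P tE iE).eval env = winW P (env .uu) (tE.eval env) (iE.eval env) := by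
  simp [winWE, winW, GExpr.eval]
/-- Value of `slotWE`. [folklore] -/
@[simp] theorem eval_slotWE (sE lE : GE) : (slotWE P sE lE).eval env = slotW P (env .uu) (sE.eval env) (lE.eval env) := by
  simp [slotWE, slotW, GExpr.eval]
/-- Value of `JFE`. [folklore] -/
@[simp] theorem eval_JFE : (JFE P).eval env = JF P (env .uu) := by
  simp only [JFE, GExpr.eval, eval_qnE, eval_RRE, eval_TnTE, JF]
/-- Value of `sqE`. [folklore] -/
@[simp] theorem eval_sqE : (sqE P).eval env = RR P (env .uu) * RR P (env .uu) := by simp [sqE, GExpr.eval]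

/-- Sums of expressions in `uu` are in `uu`. [folklore] -/
theorem inUU_add {a b : GE} (ha : InUU a) (hb : InUU b) : InUU (.add a b) := fun x hx => by
  simp only [GExpr.fv, List.mem_append] at hx
  exact hx.elim (ha x) (hb x)
/-- Products of expressions in `uu` are in `uu`. [folklore] -/
theorem inUU_mul {a b : GE} (ha : InUU a) (hb : InUU b) : InUU (.mul a b) := fun x hx => by
  simp only [GExpr.fv, List.mem_append] at hx
  exact hx.elim (ha x) (hb x)
/-- Constants are in `uu`. [folklore] -/
theorem inUU_const (c : ℕ) : InUU (.const c : GE) := fun x hx => by simp [GExpr.fv] at hx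
/-- `uu` is in `uu`. [folklore] -/
theorem inUU_uu : InUU (.var .uu : GE) := fun x hx => by simpa [GExpr.fv] using hx
/-- `qnE` mentions only `uu`. [folklore] -/
theorem inUU_qnE : InUU (qnE P) := fun x hx => inUU_uu x (CWrap.fv_polyE_sub P.q (.var .uu) x hx)
/-- `nxE` mentions only `uu`. [folklore] -/
theorem inUU_nxE : InUU (nxE P) := inUU_add (inUU_add (inUU_mul (inUU_const _) inUU_uu) (inUU_const _)) inUU_qnE
/-- `RRE` mentions only `uu`. [folklore] -/
theorem inUU_RRE : InUU (RRE P) := fun x hx => inUU_nxE x (CWrap.fv_polyE_sub P.r (nxE P) x hx)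
/-- `DDE` mentions only `uu`. [folklore] -/
theorem inUU_DDE : InUU (DDE P) :=
  inUU_add (inUU_add inUU_uu inUU_qnE) (inUU_mul inUU_RRE (inUU_add inUU_RRE (inUU_const _)))
/-- `nTE` mentions only `uu`. [folklore] -/
theorem inUU_nTE : InUU (nTE P) :=
  inUU_add inUU_DDE (inUU_add (inUU_mul (inUU_const _) inUU_uu) (inUU_const _))

end Expr

/-! ### The block describes in polynomial time -/

section Block

/-- **The block describes in polynomial time**: `1ᵘ ↦ (blkC P u).flatMap opBits ∈ FP`.
[cite: AroraBarak2009, §6.2 Def. 6.12 and Remark 6.7 (descriptions printed in polynomial time)] -/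
theorem blk_desc_mem_FP : (fun z : List Bool => (blkC P z.length).flatMap opBits) ∈ FP := by
  have h := flatMap_opBits_cleanOps_mem_FP (e := P.e) (M := P.Mtm) (DDE P) (nTE P)
    [(DDE P, .const 1), (.add (DDE P) (.const 2), .mul (.const 2) (.var .uu))] inUU_nTE
    (fun p hp => by
      simp only [List.mem_cons, List.not_mem_nil, or_false] at hp
      rcases hp with rfl | rfl
      · exact inUU_DDE
      · exact inUU_add inUU_DDE (inUU_const _))
    CWrap.vg (fun u => by
      rw [eval_DDE]
      simp only [envU, GenProg.initEnv_self, List.flatMap_cons, List.flatMap_nil, List.append_nil, GExpr.eval, eval_DDE]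
      rw [PhaseQuery.notsV_vg]
      simp)
    (fun u => by simp [nT, GenProg.initEnv])
  refine (congrArg (· ∈ FP) (funext fun z => ?_)).mpr h
  simp [blkC, GenProg.initEnv]

end Block

/-! ### Generators of the Hadamard layer, the copies, the queries and the swaps -/

section Gen

/-- **The generator of the Hadamard layer**: `H` on the coin wires `u + j`, `j < q(u)`. [folklore] -/
def hadsG : GS := .loop .jj (qnE P) (PhaseQuery.hadG (.add (.var .uu) (.var .jj)))

/-- The Hadamard generator prints `hadOps`. [folklore] -/
theorem out_hadsG (u : ℕ) : (hadsG P).out (envU u) = (hadOps P u).flatMap RtOp.toks := by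
  simp [hadsG, GStmt.out, hadOps, List.flatMap_map, GExpr.eval, envU]

/-- **The generator of the copy of field `t`** (two inputs: `uu = u`, `xn = t`). [folklore] -/
def copyG : GS :=
  .loop .jj (RRE P) (opsG [ClOp.cnot (fWE P (.add (.mul (.var .xn) (RRE P)) (.var .jj))) (winWE P (.var .xn) (.var .jj))])

/-- The copy generator prints `copyC`. [folklore] -/
theorem out_copyG (u t : ℕ) : (copyG P).out (PhaseQuery.env₂ u t) = (copyC P u t).flatMap opToks := by
  simp [copyG, GStmt.out, copyC, copyOps, copyPairs, List.flatMap_map, ClOp.map, GExpr.eval, PhaseQuery.env₂,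
    GenProg.initEnv₂]

/-- **The generator of the query of length `ℓ = jj` of round `t = xn`**: tag, arity `ℓ` as a
numeral, `1^{4(ℓ+1)}`, the `ℓ` window wires and the slot, terminator
(`RazTalMachine.oracleToks`). [folklore] -/
def orc1G : GS :=
  seqs [.emit (litT [true, true]), ticksG (.var .jj), .emit (Tok.dump true true :: litT [false, false, true, true]),
    .loop .ii (.mul (.const 4) (.add (.var .jj) (.const 1))) (.emit [Tok.lit true]),
    .emit (litT [false, false, true, true]),
    .loop .tt (.var .jj) (wireG (winWE P (.var .xn) (.var .tt))),
    wireG (slotWE P (.var .xn) (.var .jj)),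
    .emit (litT [false, true])]

/-- The query generator prints the tokens of the query. [folklore] -/
theorem out_orc1G (env : GV → ℕ) :
    (orc1G P).out env = (RtOp.oracle (qry P (env .uu) (env .xn) (env .jj)) (slotW P (env .uu) (env .xn) (env .jj))).toks := by
  simp only [orc1G, out_seqs, List.flatMap_cons, List.flatMap_nil, List.append_nil, GStmt.out, out_ticksG, out_wireG,
    GExpr.eval, eval_winWE, eval_slotWE, Function.update_self, Function.update_of_ne, ne_eq, reduceCtorEq,
    not_false_eq_true, flatMap_range_const, RtOp.toks, oracleToks, qry, List.cons_append]
  simp [litT, List.flatMap_map]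

/-- **The generator of the queries of round `t = xn`.** [folklore] -/
def orcG : GS := .loop .jj (.add (RRE P) (.const 1)) (orc1G P)

/-- The queries generator prints `orcT`. [folklore] -/
theorem out_orcG (u t : ℕ) : (orcG P).out (PhaseQuery.env₂ u t) = (orcT P u t).flatMap RtOp.toks := by
  rw [orcG, GStmt.out, orcT, List.flatMap_map]
  simp only [GExpr.eval, eval_RRE, PhaseQuery.env₂_uu]
  refine List.flatMap_congr fun ℓ _ => ?_
  rw [out_orc1G]
  simp [PhaseQuery.env₂, GenProg.initEnv₂]

/-- The swap template of front wire `j = jj` with the result wire of cell `R² + j`. [folklore] -/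
def swapT : List (ClOp GE) :=
  [ClOp.cnot (.var .jj) (fWE P (.add (sqE P) (.var .jj))), ClOp.cnot (fWE P (.add (sqE P) (.var .jj))) (.var .jj),
    ClOp.cnot (.var .jj) (fWE P (.add (sqE P) (.var .jj)))]

/-- **The generator of the output swaps.** [folklore] -/
def swapsG : GS := .loop .jj (JFE P) (opsG (swapT P))

/-- The swaps generator prints `swapsC`. [folklore] -/
theorem out_swapsG (u : ℕ) : (swapsG P).out (envU u) = (swapsC P u).flatMap opToks := by
  simp [swapsG, swapT, GStmt.out, swapsC, RevMux.swapOps, swapPairs, List.flatMap_map, List.flatMap_assoc, ClOp.map,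
    GExpr.eval, envU]

/-! #### Hygiene -/

/-- Loop variables of `wireG`: the tick counter. [folklore] -/
theorem lv_wireG' {Q : GV → Prop} (hQ : Q .ii) (w : GE) : LV Q (wireG w) := fun x hx => by
  rw [loopVars_wireG, List.mem_singleton] at hx
  exact hx ▸ hQ

/-- Loop variables of `ticksG`: the tick counter. [folklore] -/
theorem lv_ticksG' {Q : GV → Prop} (hQ : Q .ii) (w : GE) : LV Q (ticksG w) := fun x hx => by
  simp only [ticksG, GStmt.loopVars, List.mem_cons, List.not_mem_nil, or_false] at hx
  exact hx ▸ hQ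

/-- Loop variables of the query generator: tick counter and wire index. [folklore] -/
theorem lv_orc1G {Q : GV → Prop} (hii : Q .ii) (htt : Q .tt) : LV Q (orc1G P) :=
  lv_seqs fun s hs => by
    simp only [List.mem_cons, List.not_mem_nil, or_false] at hs
    rcases hs with rfl | rfl | rfl | rfl | rfl | rfl | rfl | rfl
    · exact lv_emit _
    · exact lv_ticksG' hii _
    · exact lv_emit _
    · exact lv_loop hii (lv_emit _)
    · exact lv_emit _
    · exact lv_loop htt (lv_wireG' hii _)
    · exact lv_wireG' hii _
    · exact lv_emit _

/-- The query generator reuses no loop variable. [folklore] -/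
theorem noReuse_orc1G : (orc1G P).noReuse = true :=
  noReuse_seqs _ fun s hs => by
    simp only [List.mem_cons, List.not_mem_nil, or_false] at hs
    rcases hs with rfl | rfl | rfl | rfl | rfl | rfl | rfl | rfl
    · rfl
    · simp [ticksG, GStmt.noReuse, GStmt.loopVars]
    · rfl
    · simp [GStmt.noReuse, GStmt.loopVars]
    · rfl
    · exact noReuse_loop_of (lv_wireG' (Q := (· ≠ GV.tt)) (by decide) _) (by simp [wireG, ticksG, GStmt.noReuse, GStmt.loopVars])
    · simp [wireG, ticksG, GStmt.noReuse, GStmt.loopVars]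
    · rfl

/-- The inputs are not loop variables of the generators, which reuse no loop variable. [folklore] -/
theorem hygiene :
    (GV.uu ∉ (hadsG P).loopVars ∧ (hadsG P).noReuse = true) ∧
    (GV.uu ∉ (copyG P).loopVars ∧ GV.xn ∉ (copyG P).loopVars ∧ (copyG P).noReuse = true) ∧
    (GV.uu ∉ (orcG P).loopVars ∧ GV.xn ∉ (orcG P).loopVars ∧ (orcG P).noReuse = true) ∧
    (GV.uu ∉ (swapsG P).loopVars ∧ (swapsG P).noReuse = true) := by
  have key : ∀ s : GS, LV (fun x => x = .ii ∨ x = .jj ∨ x = .tt) s → GV.uu ∉ s.loopVars ∧ GV.xn ∉ s.loopVars := fun s h =>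
    ⟨fun hu => by rcases h _ hu with h | h | h <;> exact absurd h (by decide),
      fun hu => by rcases h _ hu with h | h | h <;> exact absurd h (by decide)⟩
  have hii : (GV.ii = .ii ∨ GV.ii = .jj ∨ GV.ii = .tt) := Or.inl rfl
  have hjj : (GV.jj = .ii ∨ GV.jj = .jj ∨ GV.jj = .tt) := Or.inr (Or.inl rfl)
  have htt : (GV.tt = .ii ∨ GV.tt = .jj ∨ GV.tt = .tt) := Or.inr (Or.inr rfl)
  have k1 := key (hadsG P) (lv_loop hjj (PhaseQuery.lv_agateG hii _))
  have k2 := key (copyG P) (lv_loop hjj (lv_opsG hii _))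
  have k3 := key (orcG P) (lv_loop hjj (lv_orc1G P hii htt))
  have k4 := key (swapsG P) (lv_loop hjj (lv_opsG hii _))
  refine ⟨⟨k1.1, ?_⟩, ⟨k2.1, k2.2, ?_⟩, ⟨k3.1, k3.2, ?_⟩, ⟨k4.1, ?_⟩⟩
  · exact noReuse_loop_of (PhaseQuery.lv_agateG (Q := (· ≠ GV.jj)) (by decide) _) (PhaseQuery.noReuse_agateG _)
  · exact noReuse_loop_of (lv_opsG (P := (· ≠ GV.jj)) (by decide) _) (noReuse_opsG _)
  · exact noReuse_loop_of (lv_orc1G P (Q := (· ≠ GV.jj)) (by decide) (by decide)) (noReuse_orc1G P)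
  · exact noReuse_loop_of (lv_opsG (P := (· ≠ GV.jj)) (by decide) _) (noReuse_opsG _)

end Gen

/-! ### The parts as polynomial-time string functions -/

section FPParts

/-- The Hadamard-layer description. [folklore] -/
def hadF : List Bool → List Bool := PhaseQuery.g1F (hadsG P)

/-- `hadF ∈ FP`. [folklore] -/
theorem hadF_mem_FP : hadF P ∈ FP := PhaseQuery.g1F_mem_FP _ (hygiene P).1.1 (hygiene P).1.2

/-- **`hadF` computes the description of the Hadamard layer.** [folklore] -/
theorem hadF_apply (z : List Bool) : hadF P z = (hadOps P z.length).flatMap RtOp.bits := by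
  rw [hadF, PhaseQuery.g1F, out_hadsG, PhaseQuery.render_rtoks_nil]

/-- The block description (a function of the context length). [folklore] -/
def BF : List Bool → List Bool := fun z => (blkC P z.length).flatMap opBits

/-- The finale description: block and swaps. [folklore] -/
def finF (z : List Bool) : List Bool := BF P z ++ PhaseQuery.g1F (swapsG P) z

/-- `finF ∈ FP`. [folklore] -/
theorem finF_mem_FP : finF P ∈ FP :=
  append_mem_FP (blk_desc_mem_FP P) (PhaseQuery.g1F_mem_FP _ (hygiene P).2.2.2.1 (hygiene P).2.2.2.2)

/-- **`finF` computes the description of the finale.** [folklore] -/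
theorem finF_apply (z : List Bool) : finF P z = (fin P z.length).flatMap RtOp.bits := by
  rw [finF, fin, List.flatMap_append, blk, PhaseQuery.flatMap_bits_map_cl, PhaseQuery.flatMap_bits_map_cl, BF,
    PhaseQuery.g1F, out_swapsG, render_flatMap_opToks_nil]

/-- The block component of the round piece (a function of the context `z`). [folklore] -/
def BFz : List Bool → List Bool := BF P ∘ PhaseQuery.zOfF
/-- The copy component of the round piece. [folklore] -/
def CFz : List Bool → List Bool := PhaseQuery.g2F (copyG P) ∘ PhaseQuery.fmt2
/-- The query component of the round piece. [folklore] -/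
def OFz : List Bool → List Bool := PhaseQuery.g2F (orcG P) ∘ PhaseQuery.fmt2

/-- **The piece of round `t`**, from the record `⟨⟨z, ruler⟩, 1ᵗ⟩`: block, copy, block, queries.
[folklore] -/
def pieceF (w : List Bool) : List Bool := BFz P w ++ (CFz P w ++ (BFz P w ++ OFz P w))

/-- The two-input components are polynomial time. [folklore] -/
theorem g2F_parts_mem_FP : PhaseQuery.g2F (copyG P) ∈ FP ∧ PhaseQuery.g2F (orcG P) ∈ FP :=
  ⟨PhaseQuery.g2F_mem_FP _ (hygiene P).2.1.1 (hygiene P).2.1.2.1 (hygiene P).2.1.2.2,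
    PhaseQuery.g2F_mem_FP _ (hygiene P).2.2.1.1 (hygiene P).2.2.1.2.1 (hygiene P).2.2.1.2.2⟩

/-- `pieceF ∈ FP`. [folklore] -/
theorem pieceF_mem_FP : pieceF P ∈ FP := by
  obtain ⟨hc, ho⟩ := g2F_parts_mem_FP P
  have hz : PhaseQuery.zOfF ∈ FP := comp_mem_FP fstF_mem_FP fstF_mem_FP
  have hB : BFz P ∈ FP := comp_mem_FP (blk_desc_mem_FP P) hz
  have hC : CFz P ∈ FP := comp_mem_FP hc PhaseQuery.fmt2_mem_FP
  have hO : OFz P ∈ FP := comp_mem_FP ho PhaseQuery.fmt2_mem_FP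
  exact append_mem_FP hB (append_mem_FP hC (append_mem_FP hB hO))

/-- **`pieceF` computes the description of round `t`.** [folklore] -/
theorem pieceF_apply (z r : List Bool) (t : ℕ) :
    pieceF P (boolPair (boolPair z r) (ones t)) = (roundOps P z.length t).flatMap RtOp.bits := by
  simp only [pieceF, BFz, CFz, OFz, BF, Function.comp_apply]
  rw [PhaseQuery.fmt2_apply, PhaseQuery.zOfF_apply, PhaseQuery.g2F_fmt, PhaseQuery.g2F_fmt, out_copyG, out_orcG,
    render_flatMap_opToks_nil, PhaseQuery.render_rtoks_nil, roundOps, blk]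
  simp only [List.flatMap_append, PhaseQuery.flatMap_bits_map_cl, List.append_assoc]

end FPParts

/-! ### Folding the round pieces -/

section Fold

variable (pc po pB : Polynomial ℕ)

/-- `nx(n)` as a polynomial. [folklore] -/
def nxPoly : Polynomial ℕ := C 2 * X + C 2 + P.q
/-- `R(n)` as a polynomial. [folklore] -/
def RRPoly : Polynomial ℕ := P.r.comp (nxPoly P)

/-- Value of `RRPoly`. [folklore] -/
@[simp] theorem eval_RRPoly (n : ℕ) : (RRPoly P).eval n = RR P n := by simp [RRPoly, nxPoly, RR, nx]

/-- The ruler polynomial: room for the rounds and for every piece (the bounds `pc`, `po` of the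
two-input parts at argument length `n + R + 1`, `pB` of the block). [folklore] -/
def rulerPoly : Polynomial ℕ := RRPoly P + C 1 + ((pc + po).comp (X + RRPoly P + C 1) + C 2 * pB)

/-- The initial record of the fold: `⟨⟨z, ruler⟩, ⟨bin R, ⟨1⁰, []⟩⟩⟩`. [folklore] -/
def initL : List Bool → List Bool :=
  fanoutFn (fanoutFn (fun z => z) (polyFn (rulerPoly P pc po pB)))
    (fanoutFn (lenBinF ∘ polyFn (RRPoly P)) (fun _ => boolPair [] []))

/-- **The description of all rounds** as a string function: fold the pieces `t < R`.
[cite: AroraBarak2009, §1.3 (bounded loops)] -/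
def roundsF : List Bool → List Bool := sndPow 2 ∘ foldLoop appF (clipF 1 (pieceF P)) X ∘ initL P pc po pB

/-- `roundsF ∈ FP`. [folklore] -/
theorem roundsF_mem_FP : roundsF P pc po pB ∈ FP :=
  comp_mem_FP (sndPow_mem_FP 2) (comp_mem_FP (foldLoop_clipF_mem_FP 1 appF_mem_FP length_appF_le (pieceF_mem_FP P) X)
    (fanoutFn_mem_FP (fanoutFn_mem_FP (PolyTimeComputable.id _) (polyFn_mem_FP _))
      (fanoutFn_mem_FP (comp_mem_FP lenBinF_mem_FP (polyFn_mem_FP _)) (const_mem_FP _))))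

/-- **The fold computes the description of the rounds**, provided the parts are bounded by the
polynomials of the ruler. [folklore] -/
theorem roundsF_apply (hpc : ∀ v, (PhaseQuery.g2F (copyG P) v).length ≤ pc.eval v.length)
    (hpo : ∀ v, (PhaseQuery.g2F (orcG P) v).length ≤ po.eval v.length)
    (hpB : ∀ z : List Bool, ((blkC P z.length).flatMap opBits).length ≤ pB.eval z.length) (z : List Bool) :
    roundsF P pc po pB z = (rounds P z.length).flatMap RtOp.bits := by
  set n := z.length with hn
  set ctx := boolPair z (ones ((rulerPoly P pc po pB).eval n)) with hctx
  have hinit : initL P pc po pB z = boolPair ctx (boolPair (encodeNat (RR P n)) (boolPair (ones 0) [])) := by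
    simp [initL, fanoutFn_apply, hctx, hn, ones]
  have hrounds : RR P n ≤ (X : Polynomial ℕ).eval ctx.length := by
    rw [eval_X, hctx, length_boolPair]
    have : RR P n ≤ (rulerPoly P pc po pB).eval n := by simp [rulerPoly]; omega
    simp [ones]; omega
  have hpiece : ∀ j, 0 ≤ j → j < 0 + RR P n → (pieceF P (boolPair ctx (ones j))).length ≤ 1 * (ctx.length + 1) := by
    intro j _ hj
    have hjR : j < RR P n := by omega
    have hfmt : (List.replicate n true ++ false :: ones j).length ≤ n + RR P n + 1 := by simp [ones]; omega
    have hx : ∀ {g : List Bool → List Bool} {q : Polynomial ℕ}, (∀ v, (g v).length ≤ q.eval v.length) →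
        (g (PhaseQuery.fmt2 (boolPair ctx (ones j)))).length ≤ q.eval (n + RR P n + 1) := fun {g q} hg => by
      rw [hctx, PhaseQuery.fmt2_apply, ← hn]
      exact (hg _).trans (TM2Iter.eval_mono q hfmt)
    have hB : (BFz P (boolPair ctx (ones j))).length ≤ pB.eval n := by
      rw [BFz, Function.comp_apply, hctx, PhaseQuery.zOfF_apply, BF, ← hn]; exact hpB z
    have hc := hx (g := PhaseQuery.g2F (copyG P)) hpc
    have ho := hx (g := PhaseQuery.g2F (orcG P)) hpo
    have hr : (rulerPoly P pc po pB).eval n = RR P n + 1 + ((pc + po).eval (n + RR P n + 1) + 2 * pB.eval n) := by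
      simp [rulerPoly]
    have hcl : ctx.length = 2 * n + 2 + (rulerPoly P pc po pB).eval n := by
      rw [hctx, length_boolPair, ← hn]; simp
    rw [pieceF]
    simp only [List.length_append, CFz, OFz, Function.comp_apply, one_mul, hcl]
    simp only [eval_add] at hr
    have hB' := hB
    simp only [BFz, Function.comp_apply] at hB'
    omega
  rw [roundsF, Function.comp_apply, Function.comp_apply, hinit, foldLoop_apply appF (clipF 1 (pieceF P)) hrounds 0 [],
    sndPow_succ_boolPair, sndPow_succ_boolPair, sndPow_zero_boolPair, foldAcc_clipF hpiece, foldAcc_appF, List.nil_append,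
    rounds, List.flatMap_assoc, CWrap.flatMap_range_eq_ccat]
  refine ccat_congr fun j hj => ?_
  rw [Nat.zero_add, hctx, pieceF_apply P z _ j, ← hn]

end Fold

/-! ### The assembly -/

section Assembly

/-- `nT(n)` as a polynomial. [folklore] -/
def nTPoly : Polynomial ℕ := X + P.q + RRPoly P * (RRPoly P + C 1) + (C 2 * X + C 2)
/-- `NW(n)` as a polynomial. [folklore] -/
def NWPoly : Polynomial ℕ := (RevClean.widthPoly P.e P.Mtm).comp (nTPoly P) + RRPoly P * RRPoly P

/-- Value of `nTPoly`. [folklore] -/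
@[simp] theorem eval_nTPoly (n : ℕ) : (nTPoly P).eval n = nT P n := by
  simp [nTPoly, nT, DD, SS]

/-- Value of `NWPoly`. [folklore] -/
@[simp] theorem eval_NWPoly (n : ℕ) : (NWPoly P).eval n = NW P n := by
  rw [NW_eq]; simp only [NWPoly, eval_add, eval_mul, eval_comp, eval_nTPoly, RevClean.eval_widthPoly, eval_RRPoly, Wblk]

/-- The ancilla count in unary: `1^{NW n}` with the first `n` symbols dropped. [folklore] -/
def ancF : List Bool → List Bool := dropFn ∘ fanoutFn (fun z => z) (polyFn (NWPoly P))

/-- Value of `ancF`. [folklore] -/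
theorem ancF_apply (z : List Bool) : ancF P z = unaryEncodeNat (qn P z.length + mW P z.length) := by
  simp only [ancF, Function.comp_apply, fanoutFn_apply, dropFn_boolPair, polyFn_apply, eval_NWPoly, ones, List.drop_replicate]
  rw [RevDesc.unaryEncodeNat_eq_replicate]
  congr 1
  dsimp only [NW]; omega

/-- `ancF ∈ FP`. [folklore] -/
theorem ancF_mem_FP : ancF P ∈ FP := comp_mem_FP dropFn_mem_FP (fanoutFn_mem_FP (PolyTimeComputable.id _) (polyFn_mem_FP _))

/-- **The Hadamard layer of `coinFamily` describes as `hadOps`.** [folklore] -/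
theorem flatMap_gateEnc_hadamardLayer (n k m : ℕ) :
    (hadamardLayer n k m).flatMap gateEnc = ((List.range k).map fun j => RtOp.had (n + j)).flatMap RtOp.bits := by
  rw [hadamardLayer, coinWires, RazTalMachine.range_eq_map_finRange, List.map_map, List.map_map, List.flatMap_map,
    List.flatMap_map]
  refine List.flatMap_congr fun j _ => ?_
  simp [gateEnc_hOn, RtOp.bits, coinWire]

/-- **The description of the circuit is the concatenation of the `RtOp.bits` of `hadOps ++ body`.**
[folklore] -/
theorem encode_circ (n : ℕ) :
    QCircuit.encode ((family P).circ n) = (hadOps P n).flatMap RtOp.bits ++ (body P n).flatMap RtOp.bits := by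
  change QCircuit.encode (⟨hadamardLayer n (P.q.eval n) (mW P n) ++ (Dc P n).gates⟩ : QCircuit cliffordT _) = _
  rw [RevDesc.encode_eq_flatMap, List.flatMap_append, flatMap_gateEnc_hadamardLayer]
  congr 1
  exact flatMap_gateEnc_compileList (NW_pos P n) (body P n) (body_lt P n) _

/-- **The simulating coin family is polynomial-time uniform.**
[cite: AroraBarak2009, §6.2 Def. 6.12 and Remark 6.7 (descriptions printed in polynomial time)] -/
theorem family_isUniform : (family P).IsUniform := by
  obtain ⟨pc, hpc⟩ := exists_poly_length_le_of_mem_FP (g2F_parts_mem_FP P).1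
  obtain ⟨po, hpo⟩ := exists_poly_length_le_of_mem_FP (g2F_parts_mem_FP P).2
  obtain ⟨pB, hpB⟩ := exists_poly_length_le_of_mem_FP (blk_desc_mem_FP P)
  refine QCircuitFamily.isUniform_of_descFn_mem_FP ?_
  have h := fanoutFn_mem_FP lenBinF_mem_FP (fanoutFn_mem_FP (ancF_mem_FP P)
    (append_mem_FP (hadF_mem_FP P) (append_mem_FP (roundsF_mem_FP P pc po pB) (finF_mem_FP P))))
  have e : (family P).descFn = fanoutFn lenBinF (fanoutFn (ancF P)
      (fun z => hadF P z ++ (roundsF P pc po pB z ++ finF P z))) := by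
    funext z
    rw [fanoutFn_apply, fanoutFn_apply, lenBinF_apply, ancF_apply, QCircuitFamily.descFn_eq, hadF_apply,
      roundsF_apply P pc po pB hpc hpo hpB, finF_apply, encode_circ, body]
    simp only [List.flatMap_append]
  rw [e]
  exact h

end Assembly

end OCoin

end Literature.Computability.QuantumComplexity

end
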